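import Mathlib.Order.Filter.AtTopBot.Ring
import Literature.Computability.Cryptography.NaorReingoldFamily
import Literature.Computability.Complexity.GrowthBounds
import HarnessLib

/-!
# Superexponential truth-table hardness of the hashed Naor–Reingold family under subexponential DDH

The asymptotic end of the reduction (`NaorReingoldEnds.lean`, `NaorReingoldFamily.lean`): if the
instance sequence `⟨P_m, Q_m, g_m⟩` is `2^{m^δ}`-hard for DDH against `B₂`-circuits
(`Literature.Computability.Cryptography.DDHSubexpHard`) and the security parameter is coupled to
the input length as `m = n^k` with `k ≥ 2`, `kδ ≥ 2` (Razborov–Rudich's `n = m^{ε/2}`, Arora–Barak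
2009, §23.3), then the truth-table generators of the family `Seq.family` are superexponentially
hard in `n` (`Literature.Barriers.PneNP.SuperExpHard`: `H(tableGen F n) > 2^{Cn}` for every `C`,
eventually): a size-`2^{Cn}` test with advantage `2^{-Cn}` would give, through the explicit bound
`(n+1)Q/2^{2m} + n 2ⁿ 2^{-m^δ} + 2ⁿ/(2√Q)` and `2Q > 2^{m^δ} ≥ 2^{n²}`, a contradiction for large `n`
(`superExpHard_family`).

* `eventually_lt_two_pow_half_sq` — every exponentially bounded `f` has `f n < 2^{(n²-1)/2}`
  eventually (the only growth fact used);
* `lt_prgHardness_of_forall` — `H(G) > S₀` as soon as every `B₂`-circuit of size `≤ S₀` has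
  advantage `< 1/S₀`;
* `prgAdvantage_lt_at` — the bound at one good length; `superExpHard_family` — the assembly.

## References

* M. Naor, O. Reingold, J. ACM 51 (2004), Thm. 4.1, Thm. 4.3, p. 237.
* A. Razborov, S. Rudich, *Natural proofs*, JCSS 55 (1997), §4 (Thm. 4.1).
* S. Arora, B. Barak, *Computational Complexity: A Modern Approach*, CUP 2009, §23.3.
-/

noncomputable section

namespace Literature.Computability.Cryptography

open Finset Filter Literature.Computability.MetaComplexity Literature.Computability.Complexity
  Literature.Computability.AlgebraicComplexity Literature.Barriers.PneNP

namespace NaorReingold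

/-! ### Growth -/

/-- Every exponentially bounded function is eventually below `2^{(n² - 1)/2}`. [folklore] -/
theorem eventually_lt_two_pow_half_sq {f : ℕ → ℕ} (hf : IsExpBounded f) :
    ∀ᶠ n : ℕ in atTop, f n < 2 ^ ((n * n - 1) / 2) := by
  obtain ⟨c, hc⟩ := hf
  filter_upwards [eventually_ge_atTop (2 * c + 3)] with n hn
  refine (hc n).trans_lt (Nat.pow_lt_pow_right (by norm_num) ?_)
  have h1 : (2 * c + 3) * n ≤ n * n := Nat.mul_le_mul_right n hn
  have h2 : 2 * (c * n + c) + 2 ≤ n * n - 1 := by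
    have : 2 * c + 3 ≤ n := hn
    zify [show 1 ≤ n * n from by nlinarith] at h1 ⊢
    nlinarith
  omega

/-- `n ↦ n ^ k` is p-bounded. [folklore] -/
theorem isPBounded_pow (k : ℕ) : IsPBounded fun n : ℕ => n ^ k := ⟨k, fun _ => Nat.le_add_right _ _⟩

/-- `n ↦ (2ⁿ)^{C}` is exponentially bounded. [folklore] -/
theorem isExpBounded_two_pow_pow (C : ℕ) : IsExpBounded fun n : ℕ => 2 ^ (C * n) := by
  refine (IsExpBounded.two_pow.pow C).mono fun n => ?_
  rw [← pow_mul, mul_comm]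

/-! ### Hardness from a uniform advantage bound -/

/-- If every `B₂`-circuit of size `≤ S₀` has advantage `< 1/S₀` against `G`, then `H(G) > S₀`. [cite: RazborovRudich1997, §4 (definition of `H(G)`)] -/
theorem lt_prgHardness_of_forall {K M S₀ : ℕ} {G : (Fin K → Bool) → (Fin M → Bool)}
    (h : ∀ T : Circuit (Fin M), T.IsOver B2 → T.size ≤ S₀ → prgAdvantage T G < 1 / (S₀ : ℝ)) :
    (S₀ : ℕ∞) < prgHardness G := by
  have hstep : ((S₀ : ℕ) : ℕ∞) < ((S₀ + 1 : ℕ) : ℕ∞) := by exact_mod_cast Nat.lt_succ_self S₀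
  refine hstep.trans_le ?_
  unfold prgHardness
  refine le_iInf fun S => le_iInf fun hS => le_iInf fun hex => ?_
  obtain ⟨C, hC, hsz, hadv⟩ := hex
  have hlt : S₀ < S := by
    by_contra hle
    push Not at hle
    have h1 := h C hC (hsz.trans hle)
    have h2 : (1 : ℝ) / S₀ ≤ 1 / S := one_div_le_one_div_of_le (by exact_mod_cast hS) (by exact_mod_cast hle)
    linarith
  exact_mod_cast hlt

/-! ### The bound at one length -/

namespace Seq

variable (σ : Seq)

/-- The level parameters have input length `n`. [folklore] -/
theorem pp_n (n : ℕ) : (σ.pp n).n = n := rfl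

/-- The level parameters have word length `m = n^k`. [folklore] -/
theorem pp_m (n : ℕ) : (σ.pp n).m = σ.m n := rfl

/-- `n² ≤ m` when `k ≥ 2` and `n ≥ 1`. [folklore] -/
theorem sq_le_m {n : ℕ} (hk : 2 ≤ σ.k) (hn : 1 ≤ n) : n * n ≤ σ.m n := by
  rw [Seq.m, ← pow_two]
  exact Nat.pow_le_pow_right hn hk

/-- `2^{n²} ≤ 2^{m^δ}` when `kδ ≥ 2` and `n ≥ 1`. [cite: AroraBarakCC2009, §23.3 ("n = m^{ε/2}")] -/
theorem two_pow_sq_le_two_rpow {n : ℕ} {δ : ℝ} (hkδ : 2 ≤ (σ.k : ℝ) * δ) (hn : 1 ≤ n) :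
    (2 : ℝ) ^ (n * n) ≤ (2 : ℝ) ^ ((σ.m n : ℝ) ^ δ) := by
  have hn' : (1 : ℝ) ≤ n := by exact_mod_cast hn
  have hexp : ((n * n : ℕ) : ℝ) ≤ (σ.m n : ℝ) ^ δ := by
    rw [Seq.m, Nat.cast_pow, ← Real.rpow_natCast (n : ℝ) σ.k, ← Real.rpow_mul (by positivity)]
    rw [show ((n * n : ℕ) : ℝ) = (n : ℝ) ^ (2 : ℝ) by push_cast; rw [Real.rpow_two]; ring]
    exact Real.rpow_le_rpow_of_exponent_le hn' hkδ
  rw [← Real.rpow_natCast (2 : ℝ) (n * n)]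
  exact Real.rpow_le_rpow_of_exponent_le (by norm_num) hexp

/-- **The advantage bound at a good length.** At a length `n ≥ 1` where `⟨P_m, Q_m, g_m⟩` is an
instance, `2^{m^δ}`-hard for DDH, and the growth inequalities hold, every `B₂` truth-table test
of size `≤ 2^{C₀ n}` has advantage `< 2^{-C₀ n}` against the family. [cite: NaorReingold2004, Thm. 4.1 and Thm. 4.3; AroraBarakCC2009, §23.3] -/
theorem prgAdvantage_lt_at {n : ℕ} {δ : ℝ} (C₀ : ℕ) (hinst : σ.IsInst n)
    (hhard : ∀ C : Circuit (Fin 3 × Fin (σ.m n)), C.IsOver B2 →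
      (C.size : ℝ) ≤ (2 : ℝ) ^ ((σ.m n : ℝ) ^ δ) →
        ddhAdvantage (σ.m n) (σ.P (σ.m n)) (σ.Q (σ.m n)) (σ.g (σ.m n)) C < (2 : ℝ) ^ (-((σ.m n : ℝ) ^ δ)))
    (hM : (2 : ℝ) ^ (n * n) ≤ (2 : ℝ) ^ ((σ.m n : ℝ) ^ δ)) (hm2 : n * n ≤ σ.m n)
    (h5 : σ.m n + 1 ≤ 2 ^ (n * n))
    (h4 : 2 ^ n * (47 * (σ.m n + 2) ^ 4) + 2 ^ (C₀ * n) ≤ 2 ^ (n * n))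
    (h1 : (n + 1) * 4 * 2 ^ (C₀ * n) ≤ 2 ^ (n * n))
    (h2 : n * 2 ^ n * 4 * 2 ^ (C₀ * n) ≤ 2 ^ (n * n))
    (h3 : 2 ^ n * 4 * 2 ^ (C₀ * n) ≤ 2 ^ ((n * n - 1) / 2 + 1))
    (T : Circuit (Fin (2 ^ n))) (hT : T.IsOver B2) (hsize : T.size ≤ 2 ^ (C₀ * n)) :
    prgAdvantage T (tableGen σ.family n) < 1 / ((2 ^ (C₀ * n) : ℕ) : ℝ) := by
  -- the instance facts, in terms of the level parameters `pp`
  set pp := σ.pp n with hpp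
  obtain ⟨hP0, hP, hQ, hord⟩ := inst_facts hinst
  haveI : NeZero pp.P := ⟨hP0⟩
  have hQeq : pp.Q = σ.Q (σ.m n) := pp_Q_eq hinst
  have hprime : pp.Q.Prime := by rw [hQeq]; exact hinst.prime_Q
  rw [← hQeq] at hhard
  set M : ℝ := (2 : ℝ) ^ ((σ.m n : ℝ) ^ δ) with hMdef
  have hMpos : 0 < M := by positivity
  have hM' : (2 : ℝ) ^ (n * n) ≤ M := hM
  have h2nn : (0 : ℝ) < (2 : ℝ) ^ (n * n) := by positivity
  -- the group is large
  have hsize5 : ((pp.m + 1 : ℕ) : ℝ) ≤ M := by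
    refine le_trans ?_ hM'
    exact_mod_cast h5
  have hbig : M < 2 * pp.Q := two_rpow_lt_two_mul_Q pp hP hord hprime hsize5 hhard
  -- the DDH hypothesis at the simulator's size
  set ε : ℝ := (2 : ℝ) ^ (-((σ.m n : ℝ) ^ δ)) with hεdef
  have hεM : ε = 1 / M := by rw [hεdef, Real.rpow_neg (by norm_num), one_div]
  have hε : 0 ≤ ε := by positivity
  have hsim : (pp.simSize T : ℝ) ≤ M := by
    refine le_trans ?_ hM'
    have : pp.simSize T ≤ 2 ^ (n * n) := by
      refine le_trans ?_ h4
      unfold Params.simSize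
      exact Nat.add_le_add (Nat.mul_le_mul_left _ (entryCost_le pp)) hsize
    exact_mod_cast this
  have H : ∀ C : Circuit (Fin 3 × Fin pp.m), C.IsOver B2 → C.size ≤ pp.simSize T →
      ddhAdvantage pp.m pp.P pp.Q pp.g C ≤ ε := fun C hC hs =>
    (hhard C hC ((Nat.cast_le.2 hs).trans hsim)).le
  -- the explicit bound
  have hmain := Params.abs_uProb_seedTable_sub_uniform_le hP hQ hord T hT hε H (σ.L n)
  rw [prgAdvantage_tableGen_family hinst T]
  refine hmain.trans_lt ?_
  -- term 1: key smoothing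
  have hQ2m : (pp.Q : ℝ) ≤ (2 : ℝ) ^ pp.m := by exact_mod_cast hQ
  have hC0 : (0 : ℝ) < ((2 ^ (C₀ * n) : ℕ) : ℝ) := by positivity
  have t1 : (pp.n + 1 : ℕ) * ((pp.Q : ℝ) / 2 ^ σ.L n) ≤ 1 / 4 * (1 / ((2 ^ (C₀ * n) : ℕ) : ℝ)) := by
    have hL : (2 : ℝ) ^ σ.L n = 2 ^ pp.m * 2 ^ pp.m := by rw [Seq.L, two_mul, pow_add]; rfl
    have hq : (pp.Q : ℝ) / 2 ^ σ.L n ≤ 1 / 2 ^ pp.m := by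
      rw [hL, div_le_div_iff₀ (by positivity) (by positivity), one_mul]
      exact mul_le_mul_of_nonneg_right hQ2m (by positivity)
    have hm : (1 : ℝ) / 2 ^ pp.m ≤ 1 / 2 ^ (n * n) :=
      one_div_le_one_div_of_le h2nn (pow_le_pow_right₀ (by norm_num) hm2)
    have h1' : ((n + 1 : ℕ) : ℝ) * 4 * ((2 ^ (C₀ * n) : ℕ) : ℝ) ≤ (2 : ℝ) ^ (n * n) := by exact_mod_cast h1
    calc (pp.n + 1 : ℕ) * ((pp.Q : ℝ) / 2 ^ σ.L n) ≤ (n + 1 : ℕ) * (1 / 2 ^ (n * n)) := by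
          rw [pp_n]
          exact mul_le_mul_of_nonneg_left (hq.trans hm) (by positivity)
      _ ≤ 1 / 4 * (1 / ((2 ^ (C₀ * n) : ℕ) : ℝ)) := by
          rw [mul_one_div, show (1 : ℝ) / 4 * (1 / ((2 ^ (C₀ * n) : ℕ) : ℝ)) = 1 / (4 * ((2 ^ (C₀ * n) : ℕ) : ℝ)) by ring,
            div_le_div_iff₀ h2nn (by positivity)]
          linarith
  -- term 2: the DDH steps
  have t2 : (pp.n : ℝ) * ((2 ^ pp.n : ℕ) * ε) ≤ 1 / 4 * (1 / ((2 ^ (C₀ * n) : ℕ) : ℝ)) := by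
    rw [pp_n, hεM]
    have h2' : (n : ℝ) * ((2 ^ n : ℕ) : ℝ) * 4 * ((2 ^ (C₀ * n) : ℕ) : ℝ) ≤ (2 : ℝ) ^ (n * n) := by exact_mod_cast h2
    calc (n : ℝ) * ((2 ^ n : ℕ) * (1 / M)) ≤ (n : ℝ) * ((2 ^ n : ℕ) * (1 / 2 ^ (n * n))) := by
          refine mul_le_mul_of_nonneg_left (mul_le_mul_of_nonneg_left ?_ (by positivity)) (by positivity)
          exact one_div_le_one_div_of_le h2nn hM'
      _ = ((n : ℝ) * (2 ^ n : ℕ)) / 2 ^ (n * n) := by ring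
      _ ≤ 1 / 4 * (1 / ((2 ^ (C₀ * n) : ℕ) : ℝ)) := by
          rw [show (1 : ℝ) / 4 * (1 / ((2 ^ (C₀ * n) : ℕ) : ℝ)) = 1 / (4 * ((2 ^ (C₀ * n) : ℕ) : ℝ)) by ring,
            div_le_div_iff₀ h2nn (by positivity)]
          linarith
  -- term 3: hashing, using `Q > M/2 ≥ 2^{n² - 1} ≥ (2^t)²`
  have t3 : ((2 ^ pp.n : ℕ) : ℝ) / (2 * Real.sqrt pp.Q) ≤ 1 / 4 * (1 / ((2 ^ (C₀ * n) : ℕ) : ℝ)) := by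
    set t : ℕ := (n * n - 1) / 2 with ht
    have hQlow : (2 : ℝ) ^ (n * n - 1) ≤ pp.Q := by
      rcases Nat.eq_zero_or_pos n with rfl | hn
      · simp only [Nat.zero_mul, Nat.zero_sub, pow_zero]
        exact_mod_cast hprime.one_lt.le
      · have hnn : 1 ≤ n * n := Nat.one_le_iff_ne_zero.2 (by positivity)
        have : (2 : ℝ) ^ (n * n) = 2 * 2 ^ (n * n - 1) := by
          rw [← pow_succ']; congr 1; omega
        linarith
    have h2t : ((2 : ℝ) ^ t) ^ 2 ≤ pp.Q := by
      refine le_trans ?_ hQlow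
      rw [← pow_mul]
      exact pow_le_pow_right₀ (by norm_num) (by omega)
    have hsqrt : (2 : ℝ) ^ t ≤ Real.sqrt pp.Q := by
      rw [← Real.sqrt_sq (by positivity : (0 : ℝ) ≤ 2 ^ t)]
      exact Real.sqrt_le_sqrt h2t
    have h3' : ((2 ^ n : ℕ) : ℝ) * 4 * ((2 ^ (C₀ * n) : ℕ) : ℝ) ≤ (2 : ℝ) ^ (t + 1) := by exact_mod_cast h3
    have htpos : (0 : ℝ) < 2 ^ t := by positivity
    rw [pow_succ] at h3'
    calc ((2 ^ pp.n : ℕ) : ℝ) / (2 * Real.sqrt pp.Q) ≤ ((2 ^ n : ℕ) : ℝ) / (2 * 2 ^ t) := by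
          rw [pp_n]
          exact div_le_div_of_nonneg_left (by positivity) (by positivity) (by linarith)
      _ ≤ 1 / 4 * (1 / ((2 ^ (C₀ * n) : ℕ) : ℝ)) := by
          rw [show (1 : ℝ) / 4 * (1 / ((2 ^ (C₀ * n) : ℕ) : ℝ)) = 1 / (4 * ((2 ^ (C₀ * n) : ℕ) : ℝ)) by ring,
            div_le_div_iff₀ (by positivity) (by positivity)]
          linarith
  have hpos : (0 : ℝ) < 1 / ((2 ^ (C₀ * n) : ℕ) : ℝ) := by positivity
  linarith

/-! ### Assembly -/

/-- **Subexponential DDH-hardness of the instance sequence makes the family superexponentially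
hard for truth-table tests** (Naor–Reingold 2004, Thm. 4.1 + 4.3, combined with the
Razborov–Rudich coupling `m = n^k`, `kδ ≥ 2`). [cite: NaorReingold2004, Thm. 4.1, Thm. 4.3 and p. 237] -/
theorem superExpHard_family (hk : 2 ≤ σ.k) {δ : ℝ} (hkδ : 2 ≤ (σ.k : ℝ) * δ)
    (hhard : ∀ᶠ m : ℕ in atTop, IsDDHInstance m (σ.P m) (σ.Q m) (σ.g m) ∧
      ∀ C : Circuit (Fin 3 × Fin m), C.IsOver B2 → (C.size : ℝ) ≤ (2 : ℝ) ^ ((m : ℝ) ^ δ) →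
        ddhAdvantage m (σ.P m) (σ.Q m) (σ.g m) C < (2 : ℝ) ^ (-((m : ℝ) ^ δ))) :
    SuperExpHard σ.family := by
  intro C₀
  have hm : Tendsto σ.m atTop atTop := tendsto_pow_atTop (by omega)
  have e0 := hm.eventually hhard
  -- the growth facts
  have hmexp : IsExpBounded σ.m := IsExpBounded.of_isPBounded (isPBounded_pow σ.k)
  have ev5 := eventually_lt_two_pow_half_sq (hmexp.add (IsExpBounded.const 1))
  have ev4 := eventually_lt_two_pow_half_sq
    ((IsExpBounded.two_pow.mul ((IsExpBounded.const 47).mul ((hmexp.add (IsExpBounded.const 2)).pow 4))).add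
      (isExpBounded_two_pow_pow C₀))
  have ev1 := eventually_lt_two_pow_half_sq
    (((IsExpBounded.of_isPBounded (IsPBounded.add_holds IsPBounded.id (IsPBounded.const 1))).mul
      (IsExpBounded.const 4)).mul (isExpBounded_two_pow_pow C₀))
  have ev2 := eventually_lt_two_pow_half_sq
    ((((IsExpBounded.of_isPBounded IsPBounded.id).mul IsExpBounded.two_pow).mul (IsExpBounded.const 4)).mul
      (isExpBounded_two_pow_pow C₀))
  have ev3 := eventually_lt_two_pow_half_sq
    ((IsExpBounded.two_pow.mul (IsExpBounded.const 4)).mul (isExpBounded_two_pow_pow C₀))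
  have hhalf : ∀ n : ℕ, 2 ^ ((n * n - 1) / 2) ≤ 2 ^ (n * n) := fun n =>
    Nat.pow_le_pow_right (by norm_num) (by omega)
  filter_upwards [e0, eventually_ge_atTop 1, ev5, ev4, ev1, ev2, ev3] with n hn0 hn h5 h4 h1 h2 h3
  obtain ⟨hinst, hhardn⟩ := hn0
  refine lt_prgHardness_of_forall fun T hT hsz => ?_
  exact σ.prgAdvantage_lt_at C₀ hinst hhardn (σ.two_pow_sq_le_two_rpow hkδ hn) (σ.sq_le_m hk hn)
    (h5.le.trans (hhalf n)) (h4.le.trans (hhalf n)) (h1.le.trans (hhalf n)) (h2.le.trans (hhalf n))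
    (h3.le.trans (Nat.pow_le_pow_right (by norm_num) (Nat.le_succ _))) T hT hsz

end Seq

end NaorReingold

end Literature.Computability.Cryptography

end
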